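import Mathlib
import Literature.Computability.AlgebraicComplexity.HessianAtOrigin
import Summits.ValiantsHypothesis.ValiantsHypothesis.Theorems.GrenetZeonTwoDimCoefficientsScalingClosureRank
import Summits.ValiantsHypothesis.ValiantsHypothesis.Theorems.GrenetZeonTwoDimCoefficientsScalingAlgebra

/-!
# Crux `GrenetZeon.TwoDimCoefficients` (stmt-ValiantsHypothesis-8062), stub `stub_dualUnipotent`:
# scaling-closure — Mignon–Ressayre PASSES TO THE SHADOW (general limit step, companions allowed)

When `m ≥ 2n` the special fibre of the scaling family is no longer `c + per_n/β` but the SHADOW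
`Φ = c + per_n/β + Σ_{k ≥ 2} [D_k]_{kn}` (the scale-invariant companions survive).  The limit step still
transports the slice-wise Hessian bound to every SMOOTH zero of whatever the special fibre is:

* ★ `rank_hess0_shadow_le` — if `P ∈ ℂ[z, δ]` has special fibre `P(z, 0) = Φ(z)` and its `z`-Hessian has
  rank `≤ r` at every zero of `P` off `δ = 0`, then `rank Hess Φ(z₀) ≤ r` at every zero `z₀` of `Φ` with
  `∇Φ(z₀) ≠ 0`.

So the stub's Hessian route in the regime `m ≥ 2n` is reduced to: exhibit a smooth zero of the shadow `Φ`
with `rank Hess Φ > 2m` (memo SIXTEENTH-HAND.md: the companions `[D_k]_{kn}` are the obstruction; they vanish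
iff `deg D_k < kn`, automatic for `kn > m`).

HONEST FRAMING: an instrument; nothing about the permanent, the stub, the crux or `VP ≠ VNP` is proved here.

References: T. Mignon, N. Ressayre, Int. Math. Res. Not. 2004:79, Thm. 1.1.
-/

-- single-conjunct layout `Summits/ValiantsHypothesis/ValiantsHypothesis`: the duplicated namespace
-- component is mandated by the tree.
set_option linter.dupNamespace false
set_option autoImplicit false

noncomputable section

namespace Summit.ValiantsHypothesis.ValiantsHypothesis.Theorems.GrenetZeonTwoDimCoefficients.ScalingClosure

open MvPolynomial Matrix
open Literature.Computability.AlgebraicComplexity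

variable {σ : Type*} [Fintype σ] [DecidableEq σ]

/-- ★ **Mignon–Ressayre passes to the shadow.**  Let `P ∈ ℂ[z_σ, δ]` (`δ` = coordinate `none`) with
special fibre `P(z, 0) = Φ(z)`, and suppose the `z`-Hessian of `P` has rank `≤ r` at every zero of `P` with
`δ ≠ 0`.  Then at every zero `z₀` of `Φ` with some `∂_i Φ(z₀) ≠ 0`, `rank Hess Φ(z₀) ≤ r`.
(Slice calculus ✓ `hessian_slice`, ✓ `eval_pderiv_some_slice`; curve selection
✓ `exists_zero_off_coord_le_rank_mvPolynomial`.) [folklore] -/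
theorem rank_hess0_shadow_le (P : MvPolynomial (Option σ) ℂ) (Φ : MvPolynomial σ ℂ) (r : ℕ)
    (h0 : ∀ z : σ → ℂ, eval (fun o : Option σ => o.elim (0 : ℂ) z) P = eval z Φ)
    (hMR : ∀ x : Option σ → ℂ, x none ≠ 0 → eval x P = 0 →
      ((Matrix.of fun s t : σ => pderiv (some s) (pderiv (some t) P)).map (eval x)).rank ≤ r)
    (z₀ : σ → ℂ) (hz : eval z₀ Φ = 0) (i : σ) (hi : eval z₀ (pderiv i Φ) ≠ 0) :
    (hess0 (transl z₀ Φ)).rank ≤ r := by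
  by_contra hlt
  rw [not_le] at hlt
  set a : Option σ → ℂ := fun o => o.elim (0 : ℂ) z₀ with ha
  have hHa : (Matrix.of fun s t : σ => pderiv (some s) (pderiv (some t) P)).map (eval a) =
      hess0 (transl z₀ Φ) := hessian_slice P Φ 0 h0 z₀
  have hPa : eval a P = 0 := by rw [ha, h0, hz]
  have hPj : eval a (pderiv (some i) P) ≠ 0 := by
    rw [ha, eval_pderiv_some_slice P Φ 0 h0 z₀ i]
    exact hi
  have hr : r + 1 ≤ ((Matrix.of fun s t : σ => pderiv (some s) (pderiv (some t) P)).map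
      (eval a)).rank := by
    rw [hHa]
    exact hlt
  obtain ⟨x, hxδ, hxP, hxr⟩ := exists_zero_off_coord_le_rank_mvPolynomial P
    (Matrix.of fun s t : σ => pderiv (some s) (pderiv (some t) P)) a (i₀ := none) (j := some i)
    (Option.some_ne_none i) hPa hPj hr
  have hx0 : x none ≠ 0 := by simpa [ha] using hxδ
  have := hMR x hx0 hxP
  omega

/-- **Corollary: no smooth zero of the shadow has Hessian rank above the slice bound.**  Contrapositive
packaging used by searches for a good zero: a zero `z₀` of `Φ` with `∂_i Φ(z₀) ≠ 0` and
`r + 1 ≤ rank Hess Φ(z₀)` refutes the slice bound `r`. [folklore] -/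
theorem not_sliceBound_of_shadow_zero (P : MvPolynomial (Option σ) ℂ) (Φ : MvPolynomial σ ℂ) (r : ℕ)
    (h0 : ∀ z : σ → ℂ, eval (fun o : Option σ => o.elim (0 : ℂ) z) P = eval z Φ)
    (z₀ : σ → ℂ) (hz : eval z₀ Φ = 0) (i : σ) (hi : eval z₀ (pderiv i Φ) ≠ 0)
    (hrank : r + 1 ≤ (hess0 (transl z₀ Φ)).rank) :
    ∃ x : Option σ → ℂ, x none ≠ 0 ∧ eval x P = 0 ∧
      r + 1 ≤ ((Matrix.of fun s t : σ => pderiv (some s) (pderiv (some t) P)).map (eval x)).rank := by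
  by_contra hno
  push Not at hno
  have h := rank_hess0_shadow_le P Φ r h0 (fun x hx hP => Nat.lt_succ_iff.mp (hno x hx hP)) z₀ hz i hi
  omega

end Summit.ValiantsHypothesis.ValiantsHypothesis.Theorems.GrenetZeonTwoDimCoefficients.ScalingClosure

end
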